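import Summits.ABC.IUTFork.ForkRegions
import Summits.ABC.IUTFork.LanaRssBridge
import HarnessLib

/-!
# L-LANA objects V quinquies: every measure space is a volume container of the skeleton (XVII), `logvol_mono` DISCHARGED

Record-only file (D-0012) of the abc-iut cell (seat abc-iut-c312-4, L-LANA level; bridge N15 ↔ skel XVII
`ForkRegions`); TAKES NO SIDE on [IUTchIII] Cor. 3.12. `ForkRegions.lean` types Cor. 3.12's own nouns over a
`VolumeContainer` (carrier, admissible regions, a log-volume MONOTONE on admissible regions — a posited
field —, and a holomorphic hull as a closure operator); `ForkHaar` (XIX) and `ForkPadic` (XX) discharged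
monotonicity in the archimedean Haar model and on `ℤ_p`. This file gives the GENERAL measure-theoretic model
matching `LanaRss` (LANA §9.2 p. 46 "`{T ⊂ VC(I_v) | adelic and measurable}`", §5.2 (e) "the notion of "volume"
by Haar measure for measurable subsets in `VC(K)`"):

* `measureContainer μ hull` — ANY measure space `(Ω, μ)` with ANY closure operator `hull` on `Set Ω` is a
  `VolumeContainer`: admissible := measurable with finite nonzero measure, `ln ν̄(A) := log (μ A)`, and
  `logvol_mono` PROVED (`Measure.mono`);
* `Region.adm` / `logvol_eq_logVol` — `LanaRss`'s regions are exactly the admissible sets, with the same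
  log-volume;
* `cor312Setting` — a `Cor312Setting` (XVII) from measure-level data: possible images `U_λ` (regions),
  the `q`-image `Q` (a region), provided the hull of `⋃ U_λ` is a region ("`−|log(Θ)| ∈ ℝ`", part of the
  Corollary's statement, stays a datum); then XVII's theorems (`logvol_U_le_negLogTheta`, the three readings,
  `cor312_of_representedVol`, …) apply to real measures.

[cite: LANA2026Report, §5.2 (e) p. 29, §9.2 p. 46] [cite: DupuyHilado2025, §1 pp. 3–4] NOT here: any judgement.
-/

noncomputable section

open MeasureTheory

namespace Summit.ABC
namespace IUTFork

variable {Ω : Type} [MeasurableSpace Ω] (μ : Measure Ω)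

/-- **Every measure space (with any hull operator) is a `VolumeContainer` (XVII)**: admissible regions =
measurable sets of finite nonzero measure, `ln ν̄(A) = log μ(A)`, monotonicity PROVED.
[cite: LANA2026Report, §5.2 (e) p. 29] -/
def measureContainer (hull : ClosureOperator (Set Ω)) : VolumeContainer where
  L := Ω
  Adm A := MeasurableSet A ∧ μ A ≠ 0 ∧ μ A ≠ ⊤
  logvol A := Real.log (μ A).toReal
  logvol_mono := by
    intro A B hA hB hAB
    have hApos : 0 < (μ A).toReal := ENNReal.toReal_pos hA.2.1 hA.2.2
    have hBpos : 0 < (μ B).toReal := ENNReal.toReal_pos hB.2.1 hB.2.2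
    rw [Real.log_le_log_iff hApos hBpos]
    exact ENNReal.toReal_mono hB.2.2 (measure_mono hAB)
  hull := hull

/-- The admissible regions of the measure container are exactly `LanaRss`'s regions: a `Region μ` is
admissible … [cite: LANA2026Report, §9.2 p. 46] -/
theorem Region.adm (hull : ClosureOperator (Set Ω)) (T : Region μ) :
    (measureContainer μ hull).Adm T.carrier :=
  ⟨T.measurable, T.vol_ne_zero, T.vol_ne_top⟩

/-- … and conversely an admissible set is a region. [cite: LANA2026Report, §9.2 p. 46] -/
def regionOfAdm (hull : ClosureOperator (Set Ω)) {A : Set Ω} (h : (measureContainer μ hull).Adm A) :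
    Region μ := ⟨A, h.1, h.2.1, h.2.2⟩

/-- The container's log-volume of a region is `LanaRss`'s `logVol`. [cite: LANA2026Report, §5.2 (e) p. 29] -/
theorem logvol_eq_logVol (hull : ClosureOperator (Set Ω)) (T : Region μ) :
    (measureContainer μ hull).logvol T.carrier = T.logVol := rfl

/-- **A `Cor312Setting` (XVII) from measure-level data**: possible images `U_λ` and the `q`-image `Q` given as
regions, and the hull of `⋃ U_λ` ASSUMED admissible (the Corollary's "`−|log(Θ)| ∈ ℝ`", a datum as in XVII).
[cite: LANA2026Report, §8.1 (c),(f) pp. 40–41] -/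
def cor312Setting (hull : ClosureOperator (Set Ω)) {Idx : Type} (U : Idx → Region μ) (Q : Region μ)
    (hhull : (measureContainer μ hull).Adm (hull (⋃ i, (U i).carrier))) : Cor312Setting where
  toVolumeContainer := measureContainer μ hull
  Idx := Idx
  U i := (U i).carrier
  U_adm i := Region.adm μ hull (U i)
  Uhol_adm := hhull
  Q := Q.carrier
  Q_adm := Region.adm μ hull Q

/-- In the measure model, XVII's `−|log(q)|` is the log-volume of the `q`-region.
[cite: LANA2026Report, §8.1 (a) p. 40] -/
theorem cor312Setting_negAbsLogq (hull : ClosureOperator (Set Ω)) {Idx : Type} (U : Idx → Region μ)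
    (Q : Region μ) (hhull : (measureContainer μ hull).Adm (hull (⋃ i, (U i).carrier))) :
    (cor312Setting μ hull U Q hhull).negAbsLogq = Q.logVol := rfl

/-- … and every possible image has log-volume `≤ −|log(Θ)|` (XVII `logvol_U_le_negLogTheta`, now a statement
about a real measure). [cite: LANA2026Report, §8.3 p. 43] -/
theorem cor312Setting_logVol_U_le (hull : ClosureOperator (Set Ω)) {Idx : Type} (U : Idx → Region μ)
    (Q : Region μ) (hhull : (measureContainer μ hull).Adm (hull (⋃ i, (U i).carrier))) (i : Idx) :
    (U i).logVol ≤ (cor312Setting μ hull U Q hhull).negLogTheta :=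
  (cor312Setting μ hull U Q hhull).logvol_U_le_negLogTheta i

end IUTFork

end Summit.ABC

end
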